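import Literature.Analysis.FluidPDE.LerayHopfNSRescale
import Literature.Analysis.FluidPDE.KatoSymmetryCovariance
import HarnessLib

/-!
# Space translation of Leray–Hopf weak solutions

Analysis/FluidPDE proof file (no named facts).  The Navier–Stokes system on the whole space has constant coefficients,
so its solution classes are invariant under the spatial translations `x ↦ a + x` (Majda–Bertozzi 2002, §1.2,
Prop. 1.1: the symmetry group of the Navier–Stokes equations contains the space translations
`uᵃ(x,t) = u(x − a, t)`).  The tree already has this for classical solutions
(`IsClassicalNSSolutionOn.spaceTranslate`), Tao's class (`IsTaoSolutionOn.spaceTranslate`) and bounded weak solutions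
(`IsBoundedWeakNSSolutionOn.comp_add_space`); this file proves it for the weak (pressure-free) formulation and for
**Leray–Hopf weak solutions**, field by field, with the bookkeeping of `LerayHopfNSRescale.lean` specialised to the
pull-back along `Φ(s, y) = (s, a + y)` (all Jacobian factors are `1`):

* `IsWeakNSSolutionOn.comp_add_space` — if `u` is a weak solution on `E × [0,T)` with force `f` and datum `u₀`, so is
  `(t,x) ↦ u t (a + x)` with force `f t (a + ·)` and datum `u₀ (a + ·)` (test `u` with `ψ(t, · − a)`; translation
  invariance of Lebesgue measure);
* `hasWeakGradient_comp_add` — weak gradients translate (`HasWeakFDerivOn.comp_affine` with `γ = 1`);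
* `IsLerayHopfOn.comp_add_space` — the Leray–Hopf class is translation invariant: the `L^∞L²` bound, the `L²` slices,
  the weak gradient `G t (a + ·)` with the SAME dissipation, both energy inequalities (every term is translation
  invariant: `eEnergy_comp_add`, `kineticEnergy_comp_add`, `lintegral_add_left_eq_self`), weak `L²` continuity
  (pair against `w(−a + ·)`) and strong attainment of the datum (`eLpNorm_comp_add`).

(The translation identities for the slice functionals — `eEnergy`, kinetic energy, `L^p` norms, pairings — are private
plumbing: one-line consequences of Mathlib's `lintegral_add_left_eq_self` / `integral_add_left_eq_self`.)

## Mathlib / tree search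

Tree: `LerayHopfNSRescale.lean` (the template: `isLerayHopfOn_nsRescale`, `stPreimage_slab_Iio_of_pos`),
`aestronglyMeasurable_comp_stAffine_Ioo` (`KatoLocalCovariance.lean`), `setLIntegral_enorm_pow_stRescale`,
`IsSpaceTimeTestOn.stPull_symm`, `stPull_stPull_symm`, `timeDeriv_stPull`, `convect_stPull`, `laplacian_stPull`,
`divergence_stPull` (`SpaceTimeRescaling.lean`), `HasWeakFDerivOn.comp_affine` (`SobolevBallScaling.lean`),
`IsWeaklyDivFree.comp_sub_right` (`KatoSymmetryCovariance.lean`).  Mathlib: `lintegral_add_left_eq_self`,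
`integral_add_left_eq_self`, `measurePreserving_add_left`, `MemLp.comp_measurePreserving`,
`MeasurableEmbedding.eLpNorm_map_measure`, `map_add_left_eq_self`.

## References

* A. J. Majda, A. L. Bertozzi, *Vorticity and Incompressible Flow*, CUP 2002, §1.2 Prop. 1.1 (p. 12) (symmetry
  groups of the Navier–Stokes equations: space translations). [MajdaBertozziCUP2002]
* J. Leray, Acta Math. 63 (1934), §31 (the class of "solutions turbulentes"). [Leray1934]
-/

noncomputable section

open MeasureTheory TopologicalSpace Set Function Filter
open _root_.Topology
open scoped InnerProductSpace RealInnerProductSpace ENNReal NNReal Laplacian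

namespace Literature.Analysis.FluidPDE

/-! ### Translation of the slice functionals -/

section Slices

variable {E : Type*} [NormedAddCommGroup E] [InnerProductSpace ℝ E] [FiniteDimensional ℝ E]
  [MeasurableSpace E] [BorelSpace E]
variable {F : Type*} [NormedAddCommGroup F]

omit [FiniteDimensional ℝ E] [MeasurableSpace E] [BorelSpace E] in
/-- `Φ⁻¹((0, T) × (a + K)) = (0, T) × K` for `Φ(s, y) = (s, a + y)`. [folklore] -/
private theorem stAffine_one_preimage_Ioo_prod_image_add (a : E) (T : ℝ) (K : Set E) :
    stAffine 1 1 0 a ⁻¹' (Ioo 0 T ×ˢ ((fun y : E => a + y) '' K)) = Ioo 0 T ×ˢ K := by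
  ext ⟨s, y⟩
  simp only [mem_preimage, stAffine_apply, zero_add, one_mul, one_smul, mem_prod]
  refine and_congr Iff.rfl ⟨?_, fun hy => ⟨y, hy, rfl⟩⟩
  rintro ⟨y', hy', hyy'⟩
  have : y' = y := add_left_cancel hyy'
  rwa [← this]

/-- **Translation invariance of the extended energy**: `eEnergy (w (a + ·)) = eEnergy w`. [folklore] -/
private theorem eEnergy_comp_add (a : E) (w : E → F) : eEnergy (fun x => w (a + x)) = eEnergy w :=
  lintegral_add_left_eq_self (fun x => ‖w x‖ₑ ^ 2) a

/-- **Translation invariance of the kinetic energy**: `E(w (a + ·)) = E(w)`. [folklore] -/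
private theorem kineticEnergy_comp_add (a : E) (w : E → F) :
    VectorCalculus.kineticEnergy (fun x => w (a + x)) = VectorCalculus.kineticEnergy w := by
  unfold VectorCalculus.kineticEnergy
  rw [integral_add_left_eq_self (fun x => ‖w x‖ ^ 2) a]

/-- **Translation invariance of `L^p` norms**: `‖w (a + ·)‖_{L^p} = ‖w‖_{L^p}` (no measurability needed). [folklore] -/
private theorem eLpNorm_comp_add (p : ℝ≥0∞) (a : E) (w : E → F) :
    eLpNorm (fun x => w (a + x)) p volume = eLpNorm w p volume := by
  have hemb : MeasurableEmbedding (fun x : E => a + x) := (MeasurableEquiv.addLeft a).measurableEmbedding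
  rw [show (fun x => w (a + x)) = w ∘ (fun x : E => a + x) from rfl, ← hemb.eLpNorm_map_measure,
    map_add_left_eq_self]

/-- `w ∈ L^p ⇒ w (a + ·) ∈ L^p`. [folklore] -/
private theorem memLp_comp_add {p : ℝ≥0∞} {w : E → F} (hw : MemLp w p volume) (a : E) :
    MemLp (fun x => w (a + x)) p volume :=
  hw.comp_measurePreserving (measurePreserving_add_left volume a)

/-- **Weak gradients translate**: if `G` is a weak gradient of `w`, then `G (a + ·)` is a weak gradient of `w (a + ·)`
(chain rule on the test function and the substitution `y = a + x`; Evans, *PDE*, §5.2.1; tree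
`HasWeakFDerivOn.comp_affine` with `γ = 1`). [cite: Evans2010, §5.2.1] -/
theorem hasWeakGradient_comp_add {F' : Type*} [NormedAddCommGroup F'] [InnerProductSpace ℝ F']
    {w : E → F'} {G : E → E →L[ℝ] F'} (h : HasWeakGradient w G) (a : E) :
    HasWeakGradient (fun x => w (a + x)) (fun x => G (a + x)) := by
  have h1 := FunctionSpaces.HasWeakFDerivOn.comp_affine one_pos a h
  have hpre : FunctionSpaces.affinePreimage 1 a (⊤ : Opens E) = ⊤ := by
    ext y; simp
  rw [hpre] at h1
  simpa only [one_smul] using h1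

/-- **Translation of pairings**: `∫ ⟪U (a + x), Φ x⟫ dx = ∫ ⟪U y, Φ (−a + y)⟫ dy`. [folklore] -/
private theorem integral_inner_comp_add {F' : Type*} [NormedAddCommGroup F'] [InnerProductSpace ℝ F'] (a : E)
    (U Φ : E → F') : ∫ x, ⟪U (a + x), Φ x⟫ = ∫ y, ⟪U y, Φ (-a + y)⟫ := by
  have h1 : (fun x => ⟪U (a + x), Φ x⟫) = fun x => (fun y => ⟪U y, Φ (-a + y)⟫) (a + x) := by
    funext x
    simp only [neg_add_cancel_left]
  rw [h1, integral_add_left_eq_self (fun y => ⟪U y, Φ (-a + y)⟫) a]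

end Slices

/-! ### The weak formulation under space translation -/

section Weak

variable {E : Type*} [NormedAddCommGroup E] [InnerProductSpace ℝ E] [FiniteDimensional ℝ E]
  [MeasurableSpace E] [BorelSpace E]

/-- **Space translation of weak solutions.**  If `u` is a weak solution on `E × [0, T)` with viscosity `ν`, force `f`
and datum `u₀`, then `(t, x) ↦ u t (a + x)` is a weak solution on `[0, T)` with force `f t (a + ·)` and datum
`u₀ (a + ·)`: against a divergence-free test field `ψ` one tests `u` with `ψ(t, · − a)`; every term of the weak identity
is translation invariant (Majda–Bertozzi 2002, §1.2 Prop. 1.1). [cite: MajdaBertozziCUP2002, §1.2 Prop. 1.1 (p. 12)] -/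
theorem IsWeakNSSolutionOn.comp_add_space {T ν : ℝ} {f u : ℝ → E → E} {u₀ : E → E}
    (h : IsWeakNSSolutionOn T ν f u₀ u) (a : E) :
    IsWeakNSSolutionOn T ν (fun t x => f t (a + x)) (fun x => u₀ (a + x)) (fun t x => u t (a + x)) := by
  obtain ⟨hmeas, hloc, hdiv, hweak⟩ := h
  refine ⟨?_, fun K hK => ?_, ?_, fun ψ hψ hψdiv => ?_⟩
  · -- measurability on the slab `(0, T) × E`
    have h1 := aestronglyMeasurable_comp_stAffine_Ioo one_pos one_pos a hmeas
    have h2 : uncurry (fun t x => u t (a + x)) = uncurry u ∘ stAffine 1 1 0 a := by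
      funext z
      obtain ⟨s, y⟩ := z
      simp [stAffine]
    rw [h2]
    rwa [div_one] at h1
  · -- local square integrability up to the time boundary
    have h1 := setLIntegral_enorm_pow_stRescale one_pos one_pos 0 a 1 u
      (Ioo 0 T ×ˢ ((fun y : E => a + y) '' K)) 2
    rw [stAffine_one_preimage_Ioo_prod_image_add] at h1
    have h2 : ∀ z : ℝ × E, ((1 : ℝ) • stPull 1 1 0 a u) z.1 z.2 = u z.1 (a + z.2) := by
      intro z
      simp [smul_stPull_apply]
    simp_rw [h2] at h1
    show ∫⁻ z in Ioo 0 T ×ˢ K, ‖u z.1 (a + z.2)‖ₑ ^ 2 < ∞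
    rw [h1]
    exact ENNReal.mul_lt_top (ENNReal.mul_lt_top (ENNReal.pow_lt_top enorm_lt_top) ENNReal.ofReal_lt_top)
      (hloc _ (hK.image (continuous_const.add continuous_id)))
  · -- weak divergence-freeness of a.e. slice
    filter_upwards [hdiv] with s hs
    have e : (fun x => u s (a + x)) = fun x => u s (x - -a) := by
      funext x; rw [sub_neg_eq_add, add_comm]
    rw [e]
    exact hs.comp_sub_right (-a)
  · -- the weak identity: test `u` with `ψ(t, · − a)`
    have hψ1 : IsSpaceTimeTestOn (stPreimage 1 1 0 a (slab E (Iio T) isOpen_Iio)) ψ := by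
      rw [stPreimage_slab_Iio_of_pos one_pos, div_one]; exact hψ
    set ψ' := stPull (1 : ℝ)⁻¹ (1 : ℝ)⁻¹ (-((1 : ℝ)⁻¹ * 0)) (-((1 : ℝ)⁻¹ • a)) ψ with hψ'_def
    have hψ'Q : IsSpaceTimeTestOn (slab E (Iio T) isOpen_Iio) ψ' := hψ1.stPull_symm one_ne_zero one_ne_zero
    have hrepr : ψ = stPull 1 1 0 a ψ' := (stPull_stPull_symm one_ne_zero one_ne_zero 0 a ψ).symm
    have hdiv' : ∀ t, VectorCalculus.IsDivFree (ψ' t) := by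
      intro t x
      have h0 := hψdiv (-((1 : ℝ)⁻¹ * 0) + (1 : ℝ)⁻¹ * t) (-((1 : ℝ)⁻¹ • a) + (1 : ℝ)⁻¹ • x)
      rw [hψ'_def, divergence_stPull, h0, mul_zero]
    have hid := hweak ψ' hψ'Q hdiv'
    set I : ℝ → E → ℝ := fun t x => ⟪u t x, timeDeriv ψ' t x⟫ + ⟪u t x, convect (u t) (ψ' t) x⟫ +
      ν * ⟪u t x, Δ (ψ' t) x⟫ + ⟪f t x, ψ' t x⟫ with hI
    have key : ∀ s y, ⟪u s (a + y), timeDeriv ψ s y⟫ +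
        ⟪u s (a + y), convect (fun x => u s (a + x)) (ψ s) y⟫ +
        ν * ⟪u s (a + y), Δ (ψ s) y⟫ + ⟪f s (a + y), ψ s y⟫ = I s (a + y) := by
      intro s y
      conv_lhs => rw [hrepr]
      rw [timeDeriv_stPull, convect_stPull,
        laplacian_stPull _ _ _ _ _ _ _ (hψ'Q.contDiff_slice_two _), stPull_apply, hI]
      simp only [zero_add, one_mul, one_smul, one_pow, convect_apply]
    have hA : ∫ s in Ioo 0 T, ∫ y, (⟪u s (a + y), timeDeriv ψ s y⟫ +
        ⟪u s (a + y), convect (fun x => u s (a + x)) (ψ s) y⟫ +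
        ν * ⟪u s (a + y), Δ (ψ s) y⟫ + ⟪f s (a + y), ψ s y⟫) = ∫ t in Ioo 0 T, ∫ x, I t x := by
      simp_rw [key]
      exact setIntegral_congr_fun measurableSet_Ioo fun s _ => integral_add_left_eq_self (I s) a
    have hB : ∫ y, ⟪u₀ (a + y), ψ 0 y⟫ = ∫ x, ⟪u₀ x, ψ' 0 x⟫ := by
      have e : ∀ y, ⟪u₀ (a + y), ψ 0 y⟫ = (fun x => ⟪u₀ x, ψ' 0 x⟫) (a + y) := by
        intro y
        conv_lhs => rw [hrepr]
        simp only [stPull_apply, mul_zero, add_zero, one_smul]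
      simp_rw [e]
      exact integral_add_left_eq_self (fun x => ⟪u₀ x, ψ' 0 x⟫) a
    rw [hA, hB]
    exact hid

end Weak

/-! ### Leray–Hopf solutions under space translation -/

section LerayHopf

variable {E : Type*} [NormedAddCommGroup E] [InnerProductSpace ℝ E] [FiniteDimensional ℝ E]
  [MeasurableSpace E] [BorelSpace E]

/-- **Space translation of Leray–Hopf weak solutions** (Majda–Bertozzi 2002, §1.2 Prop. 1.1; Leray 1934 §31).  If `u` is a
Leray–Hopf weak solution on `E × [0, T)` with viscosity `ν`, force `f` and datum `u₀`, then for every `a : E` the translate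
`(t, x) ↦ u t (a + x)` is a Leray–Hopf weak solution on `[0, T)` with force `f t (a + ·)` and datum `u₀ (a + ·)`: the weak
formulation is `IsWeakNSSolutionOn.comp_add_space`; the weak gradient translates to `G t (a + ·)` with the same
dissipation; kinetic energy, dissipation and forcing work are translation invariant, so both energy inequalities are
preserved verbatim; weak `L²` continuity pairs against `w(−a + ·)`; strong attainment of the datum by `eLpNorm_comp_add`.
[cite: MajdaBertozziCUP2002, §1.2 Prop. 1.1 (p. 12)] -/
theorem IsLerayHopfOn.comp_add_space {T ν : ℝ} {f u : ℝ → E → E} {u₀ : E → E}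
    (h : IsLerayHopfOn T ν f u₀ u) (a : E) :
    IsLerayHopfOn T ν (fun t x => f t (a + x)) (fun x => u₀ (a + x)) (fun t x => u t (a + x)) := by
  refine
    { weak := h.weak.comp_add_space a
      energy_bound := ?_
      memLp := fun s hs => memLp_comp_add (h.memLp s hs) a
      weakGrad_energy := ?_
      weak_continuous := fun w hw => ?_
      strong_initial := ?_ }
  · -- `L^∞(0, T; L²)`
    obtain ⟨C, hC⟩ := h.energy_bound
    refine ⟨C, ?_⟩
    filter_upwards [hC] with s hs
    have e : eEnergy (fun x => u s (a + x)) = eEnergy (u s) := eEnergy_comp_add a (u s)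
    show eEnergy (fun x => u s (a + x)) ≤ C
    rw [e]; exact hs
  · -- weak gradient `G t (a + ·)` and the two energy inequalities
    obtain ⟨G, hG, hGint, h0, hae⟩ := h.weakGrad_energy
    have hdiss : ∀ τ, ∫⁻ x, ENNReal.ofReal (frobeniusNormSq (G τ (a + x))) =
        ∫⁻ x, ENNReal.ofReal (frobeniusNormSq (G τ x)) :=
      fun τ => lintegral_add_left_eq_self (fun x => ENNReal.ofReal (frobeniusNormSq (G τ x))) a
    have hwork : ∀ s t : ℝ, ∫ τ in s..t, ∫ x, ⟪f τ (a + x), u τ (a + x)⟫ = ∫ τ in s..t, ∫ x, ⟪f τ x, u τ x⟫ :=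
      fun s t => intervalIntegral.integral_congr fun τ _ =>
        integral_add_left_eq_self (fun x => ⟪f τ x, u τ x⟫) a
    refine ⟨fun t x => G t (a + x), ?_, ?_, fun t ht => ?_, ?_⟩
    · filter_upwards [hG] with s hs
      exact hasWeakGradient_comp_add hs a
    · simp_rw [hdiss]; exact hGint
    · have h1 := h0 t ht
      simp_rw [hdiss]
      rw [kineticEnergy_comp_add a (u t), kineticEnergy_comp_add a u₀, hwork]
      exact h1
    · filter_upwards [hae] with s hs t hst
      have h1 := hs t hst
      simp_rw [hdiss]
      rw [kineticEnergy_comp_add a (u t), kineticEnergy_comp_add a (u s), hwork]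
      exact h1
  · -- weak `L²` continuity on `(0, T]` and the weak initial limit
    have hw' : MemLp (fun y => w (-a + y)) 2 volume := memLp_comp_add hw (-a)
    obtain ⟨hcont, hlim⟩ := h.weak_continuous (fun y => w (-a + y)) hw'
    have e : (fun t => ∫ x, ⟪u t (a + x), w x⟫) = fun t => ∫ y, ⟪u t y, w (-a + y)⟫ := by
      funext t; exact integral_inner_comp_add a (u t) w
    have e0 : ∫ x, ⟪u₀ (a + x), w x⟫ = ∫ y, ⟪u₀ y, w (-a + y)⟫ := integral_inner_comp_add a u₀ w
    refine ⟨?_, ?_⟩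
    · show ContinuousOn (fun t => ∫ x, ⟪u t (a + x), w x⟫) (Ioc 0 T)
      rw [e]; exact hcont
    · show Tendsto (fun t => ∫ x, ⟪u t (a + x), w x⟫) (𝓝[>] 0) (𝓝 (∫ x, ⟪u₀ (a + x), w x⟫))
      rw [e, e0]; exact hlim
  · -- the datum is attained strongly in `L²`
    have e : (fun t => eLpNorm ((fun t x => u t (a + x)) t - fun x => u₀ (a + x)) 2 volume) =
        fun t => eLpNorm (u t - u₀) 2 volume := by
      funext t
      exact eLpNorm_comp_add 2 a (u t - u₀)
    rw [e]
    exact h.strong_initial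

end LerayHopf

end Literature.Analysis.FluidPDE

end
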